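import Summits.BirchSwinnertonDyer.Rank1Residual.Additive.X3BranchLayerTwoFieldDegree
import Summits.BirchSwinnertonDyer.Rank1Residual.Additive.X3BranchKummerLayerCubeAtThreeTable
import Summits.BirchSwinnertonDyer.Rank1Residual.Additive.X3BranchKummerLayerUnits
import Summits.BirchSwinnertonDyer.Rank1Residual.Additive.X3BranchKummerLayerTwistedInertia
import Mathlib.RingTheory.Polynomial.Dickson
import HarnessLib

/-!
# X3, the DEGENERATE rows OFF the sub-locus, LAYER TWO: the Kummer class of a `Σ₀`-unit of the second
# layer `ℚ_2 = ℚ(θ₂)` lies in Greenberg–Vatsal's `U` — WITHOUT explicit conjugates (cell `bsd-eis`, seat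
# `bsd-eis-x3` gen 8; the layer-`2` analogue of gen 7's `X3BranchKummerLayerUnits.lean`, with the nine
# conjugates of `θ₂` handled abstractly through DICKSON polynomials (`τθ₂ = D_u(θ₂)`, so `ℤ[θ₂]` is
# `Γ_ℚ`-stable) and the local cube at `3` through the multiplication-table lemma of
# `X3BranchKummerLayerCubeAtThreeTable.lean`; x3-MEMO-10 §5; route K1 `AdditiveBranchIMC`, crux
# `GordTwoRankZeroOffCaseOne` — supports only)

HONEST FRAMING (`run/shared/lean/pub/bsd-eis/README.md` §4): THEOREMS ONLY (no `def`, no named fact,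
no `sorry`); nothing is booked; no label, tier or count of record moves.

## What (`θ₂ = ζ + ζ²⁶`, `ζ` a primitive `27`-th root of unity; `a = Σ_{k<9} P_k θ₂^k`)

* §1 `exists_intVector9_smul` — `Γ_ℚ`-STABILITY of `ℤ[θ₂]`: for `τ ∈ Γ_ℚ` and `t ∈ ℤ⁹` there is
  `t' ∈ ℤ⁹` with `τ(Σ t_k θ₂^k) = Σ t'_k θ₂^k` (`τζ = ζ^u`, `τθ₂ = ζ^u + ζ^{−u} = D_u(θ₂)` with Mathlib's
  `Polynomial.dickson 1 1 u`, then reduction modulo the monic nonic `f₉`);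
  `eq_zero_of_sum9_eq_zero` (independence of `1, θ₂, …, θ₂⁸`); `isIntegral_sum9`.
* §2 `exists_goodRoot_layerTwo` — from ONE certificate `a·D(θ₂)³ = 1 + 9T(θ₂)` and the multiplication
  table `θ₂^iθ₂^j = Σ_k μ_{kij} θ₂^k`: for EVERY `τ ∈ Γ_ℚ` a cube root of `τa` fixed by every `σ ∈ D_{v₃}`
  with `σθ₂ = θ₂` (apply `τ` to the certificate, §1, `exists_cubeRoot_smul_eq_self_of_decomp_table`).
* §3 `kummerClass_mem_unramifiedSelmer_layerTwo` — for `a` with a cofactor `b = Σ B_k θ₂^k`, `a·b = n ≠ 0`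
  supported on `Σ₀`, and one cube certificate: the class on `G_{ℚ_∞}` of the Kummer cocycle of any cube
  root of `a` lies in `unramifiedSelmer` (conjugates `τa`, `τb = n/τa` via §1; inertia lemma of gen 7;
  at `3` by §2).
References: [GreenbergVatsal2000] §2 pp. 28–30; [SerreLocalFields1979] Ch. X §3; [Washington1997]
§13.1; [LidlNiederreiter1997] §7.2 (Dickson polynomials; method).
-/

set_option autoImplicit false

noncomputable section

open scoped Classical NumberField

namespace Summit.BirchSwinnertonDyer.Rank1Residual.Additive

namespace LayerTwoField

open NumberField IsDedekindDomain Field Polynomial Finset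
  Literature.NumberTheory.GaloisRepresentations
  Literature.NumberTheory.EllipticCurves
  Literature.NumberTheory.EllipticCurves.GreenbergSelmer
  Literature.NumberTheory.EllipticCurves.GreenbergVatsal2000
  Literature.NumberTheory.NumberFields
  KummerLineClasses KummerLayerClasses

/-! ### §1 `ℤ[θ₂]` is stable under `Γ_ℚ` -/

/-- Evaluation of an integer `9`-vector polynomial. [folklore] -/
theorem aeval_sum9 (x : AlgebraicClosure ℚ) (t : Fin 9 → ℤ) :
    aeval x (∑ k : Fin 9, C (t k) * X ^ (k : ℕ)) = ∑ k : Fin 9, (t k : AlgebraicClosure ℚ) * x ^ (k : ℕ) := by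
  simp only [map_sum, map_mul, map_pow, aeval_C, aeval_X]
  simp only [eq_intCast]

/-- `σ(Σ t_k x^k) = Σ t_k (σx)^k`. [folklore] -/
theorem smul_sum9 (σ : absoluteGaloisGroup ℚ) (x : AlgebraicClosure ℚ) (t : Fin 9 → ℤ) :
    σ • (∑ k : Fin 9, (t k : AlgebraicClosure ℚ) * x ^ (k : ℕ)) =
      ∑ k : Fin 9, (t k : AlgebraicClosure ℚ) * (σ • x) ^ (k : ℕ) := by
  rw [← aeval_sum9, ← aeval_sum9, KummerLayerTwisted.smul_aeval_eq]

/-- **Reduction to the power basis**: for every `G ∈ ℤ[X]` there is `t' ∈ ℤ⁹` with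
`G(θ₂) = Σ_{k<9} t'_k θ₂^k` (reduce modulo the monic nonic `f₉`, `f₉(θ₂) = 0`). [folklore] -/
theorem exists_intVector9_aeval {ζ : AlgebraicClosure ℚ} (hζ : IsPrimitiveRoot ζ 27) (G : ℤ[X]) :
    ∃ t' : Fin 9 → ℤ, aeval (ζ + ζ ^ 26) G = ∑ k : Fin 9, (t' k : AlgebraicClosure ℚ) * (ζ + ζ ^ 26) ^ (k : ℕ) := by
  set f : ℤ[X] := X ^ 9 - 9 * X ^ 7 + 27 * X ^ 5 - 30 * X ^ 3 + 9 * X + 1 with hf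
  have hfm : f.Monic := by rw [hf]; monicity!
  have hfdeg : f.natDegree = 9 := by rw [hf]; compute_degree!
  have hfθ : aeval (ζ + ζ ^ 26) f = 0 := aeval_nonic_eq_zero hζ
  set G' := G %ₘ f with hG'
  have hG'eval : aeval (ζ + ζ ^ 26) G' = aeval (ζ + ζ ^ 26) G := by
    rw [hG', modByMonic_eq_sub_mul_div G f, map_sub, map_mul, hfθ, zero_mul, sub_zero]
  have hdeg : G'.natDegree < 9 := by
    have hne : f ≠ 1 := by
      intro h1; have := congrArg natDegree h1; rw [hfdeg, natDegree_one] at this; omega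
    have h := natDegree_modByMonic_lt G hfm hne
    rwa [hfdeg] at h
  refine ⟨fun k ↦ G'.coeff k, ?_⟩
  rw [← hG'eval, aeval_eq_sum_range' hdeg, Finset.sum_range (fun i ↦ G'.coeff i • (ζ + ζ ^ 26) ^ i)]
  refine Finset.sum_congr rfl fun k _ ↦ ?_
  rw [Algebra.smul_def]
  simp only [eq_intCast]

/-- **`ℤ[θ₂]` is `Γ_ℚ`-stable**: `τθ₂ = ζ^u + ζ^{−u} = D_u(θ₂)` (Dickson polynomial), so
`τ(Σ t_k θ₂^k) = Σ t'_k θ₂^k` for some `t' ∈ ℤ⁹`. [cite: LidlNiederreiter1997, §7.2 (method)]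
[cite: Washington1997, §13.1] -/
theorem exists_intVector9_smul {ζ : AlgebraicClosure ℚ} (hζ : IsPrimitiveRoot ζ 27)
    (τ : absoluteGaloisGroup ℚ) (t : Fin 9 → ℤ) :
    ∃ t' : Fin 9 → ℤ, τ • (∑ k : Fin 9, (t k : AlgebraicClosure ℚ) * (ζ + ζ ^ 26) ^ (k : ℕ)) =
      ∑ k : Fin 9, (t' k : AlgebraicClosure ℚ) * (ζ + ζ ^ 26) ^ (k : ℕ) := by
  -- `τζ = ζ^u`
  have h27 : (τ • ζ) ^ 27 = 1 := by rw [← smul_pow', hζ.pow_eq_one, smul_one]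
  obtain ⟨u, -, hu⟩ := hζ.eq_pow_of_pow_eq_one h27
  -- `τθ₂ = D_u(θ₂)`
  have hζ0 : ζ ≠ 0 := hζ.ne_zero (by norm_num)
  have hinv : ζ * ζ ^ 26 = 1 := by rw [← pow_succ', hζ.pow_eq_one]
  have hD : τ • (ζ + ζ ^ 26) = aeval (ζ + ζ ^ 26) (dickson 1 (1 : ℤ) u) := by
    rw [smul_add, smul_pow', ← hu, aeval_def, eval₂_eq_eval_map, map_dickson, map_one,
      dickson_one_one_eval_add_inv ζ (ζ ^ 26) hinv u, ← pow_mul, ← pow_mul, mul_comm 26 u, pow_mul]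
  -- `τ(Σ t_k θ₂^k) = G(θ₂)`, `G = Σ t_k D_u^k`
  have hG : τ • (∑ k : Fin 9, (t k : AlgebraicClosure ℚ) * (ζ + ζ ^ 26) ^ (k : ℕ)) =
      aeval (ζ + ζ ^ 26) (∑ k : Fin 9, C (t k) * dickson 1 (1 : ℤ) u ^ (k : ℕ)) := by
    rw [smul_sum9, hD]
    simp only [map_sum, map_mul, map_pow, aeval_C]
    simp only [eq_intCast]
  obtain ⟨t', ht'⟩ := exists_intVector9_aeval hζ (∑ k : Fin 9, C (t k) * dickson 1 (1 : ℤ) u ^ (k : ℕ))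
  exact ⟨t', hG.trans ht'⟩

/-- **Independence of `1, θ₂, …, θ₂⁸`**: `Σ_{k<9} c_k θ₂^k = 0` with `c ∈ ℤ⁹` forces `c = 0` (the minimal
polynomial has degree `9`). [folklore] -/
theorem eq_zero_of_sum9_eq_zero {κ : ZpExtension ℚ 3} (hκ : κ.IsCyclotomic)
    {ζ : AlgebraicClosure ℚ} (hζ : IsPrimitiveRoot ζ 27) {c : Fin 9 → ℤ}
    (h : ∑ k : Fin 9, (c k : AlgebraicClosure ℚ) * (ζ + ζ ^ 26) ^ (k : ℕ) = 0) : c = 0 := by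
  set Pc : ℤ[X] := ∑ k : Fin 9, C (c k) * X ^ (k : ℕ) with hPc
  have h0 : aeval (ζ + ζ ^ 26) Pc = 0 := by rw [hPc, aeval_sum9]; exact h
  have hint : IsIntegral ℤ (ζ + ζ ^ 26) :=
    (hζ.isIntegral (by norm_num)).add ((hζ.isIntegral (by norm_num)).pow 26)
  have hdvd : minpoly ℤ (ζ + ζ ^ 26) ∣ Pc := minpoly.isIntegrallyClosed_dvd hint h0
  rw [minpoly_int_theta27 hκ hζ] at hdvd
  have hdeg9 : (X ^ 9 - 9 * X ^ 7 + 27 * X ^ 5 - 30 * X ^ 3 + 9 * X + 1 : ℤ[X]).natDegree = 9 := by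
    compute_degree!
  have hPc0 : Pc = 0 := by
    by_contra hne
    have hle := Polynomial.natDegree_le_of_dvd hdvd hne
    rw [hdeg9] at hle
    have hlt : Pc.natDegree < 9 := by
      rw [hPc]
      refine lt_of_le_of_lt (Polynomial.natDegree_sum_le _ _) ?_
      refine lt_of_le_of_lt (Finset.sup_le fun k _ ↦ ?_) (by norm_num : 8 < 9)
      calc (C (c k) * X ^ (k : ℕ)).natDegree ≤ (k : ℕ) := Polynomial.natDegree_C_mul_X_pow_le _ _
        _ ≤ 8 := Nat.lt_succ_iff.mp k.2
    omega
  funext k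
  have hk := congrArg (fun P : ℤ[X] ↦ P.coeff k) hPc0
  simp only [hPc, finsetSum_coeff, coeff_C_mul_X_pow, coeff_zero] at hk
  rw [Finset.sum_eq_single k] at hk
  · simpa using hk
  · intro j _ hj
    rw [if_neg]
    exact fun e ↦ hj (Fin.ext e.symm)
  · intro hk'; exact absurd (Finset.mem_univ k) hk'

/-- **Integrality** of `Σ c_k θ₂^k`, `c ∈ ℤ⁹`. [folklore] -/
theorem isIntegral_sum9 {ζ : AlgebraicClosure ℚ} (hζ : IsPrimitiveRoot ζ 27) (c : Fin 9 → ℤ) :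
    IsIntegral (𝓞 ℚ) (∑ k : Fin 9, (c k : AlgebraicClosure ℚ) * (ζ + ζ ^ 26) ^ (k : ℕ)) := by
  have hζint : IsIntegral (𝓞 ℚ) ζ := (hζ.isIntegral (by norm_num)).tower_top
  have hθint : IsIntegral (𝓞 ℚ) (ζ + ζ ^ 26) := hζint.add (hζint.pow 26)
  rw [← aeval_sum9]
  exact KummerLayerTwisted.isIntegral_aeval_int hθint _

/-! ### §2 A good cube root for EVERY conjugate, from one certificate and the table -/

/-- **The good cube root of a conjugate.** `a = Σ P_k θ₂^k` with a certificate
`a·(Σ D_k θ₂^k)³ = 1 + 9 Σ T_k θ₂^k` and the multiplication table `θ₂^iθ₂^j = Σ_k μ_{kij} θ₂^k`: for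
every `τ ∈ Γ_ℚ` there is a cube root `βτ` of `τa` fixed by every `σ ∈ D_{v₃}` with `σθ₂ = θ₂`.
[cite: Cassels1986, Ch. 4 Lemma 3.1] [cite: NeukirchANT1999, Ch. II (9.6)] -/
theorem exists_goodRoot_layerTwo {κ : ZpExtension ℚ 3} (hκ : κ.IsCyclotomic)
    {ζ : AlgebraicClosure ℚ} (hζ : IsPrimitiveRoot ζ 27) (μ : Fin 9 → Fin 9 → Fin 9 → ℤ)
    (hθtab : ∀ i j : Fin 9, (ζ + ζ ^ 26) ^ (i : ℕ) * (ζ + ζ ^ 26) ^ (j : ℕ) =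
      ∑ k : Fin 9, (μ k i j : AlgebraicClosure ℚ) * (ζ + ζ ^ 26) ^ (k : ℕ))
    (P D T : Fin 9 → ℤ)
    (hcube : (∑ k : Fin 9, (P k : AlgebraicClosure ℚ) * (ζ + ζ ^ 26) ^ (k : ℕ)) *
      (∑ k : Fin 9, (D k : AlgebraicClosure ℚ) * (ζ + ζ ^ 26) ^ (k : ℕ)) ^ 3 =
      1 + 9 * ∑ k : Fin 9, (T k : AlgebraicClosure ℚ) * (ζ + ζ ^ 26) ^ (k : ℕ))
    (τ : absoluteGaloisGroup ℚ) :
    ∃ βτ : AlgebraicClosure ℚ,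
      βτ ^ 3 = τ • (∑ k : Fin 9, (P k : AlgebraicClosure ℚ) * (ζ + ζ ^ 26) ^ (k : ℕ)) ∧
      ∀ σ ∈ decomp ((Rat.HeightOneSpectrum.primesEquiv (R := 𝓞 ℚ)).symm ⟨3, Nat.prime_three⟩),
        σ • (ζ + ζ ^ 26) = ζ + ζ ^ 26 → σ • βτ = βτ := by
  set θ := ζ + ζ ^ 26 with hθdef
  obtain ⟨D', hD'⟩ := exists_intVector9_smul hζ τ D
  obtain ⟨T', hT'⟩ := exists_intVector9_smul hζ τ T
  set d' : AlgebraicClosure ℚ := ∑ k : Fin 9, (D' k : AlgebraicClosure ℚ) * θ ^ (k : ℕ) with hd'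
  -- `τa · d'³ = 1 + 9 T'(θ₂)`
  have h9 : τ • (9 : AlgebraicClosure ℚ) = 9 := by
    rw [absoluteGaloisGroup.smul_def, map_ofNat]
  have hcube' : τ • (∑ k : Fin 9, (P k : AlgebraicClosure ℚ) * θ ^ (k : ℕ)) * d' ^ 3 =
      1 + 9 * ∑ k : Fin 9, (T' k : AlgebraicClosure ℚ) * θ ^ (k : ℕ) := by
    have h := congrArg (fun z ↦ τ • z) hcube
    simp only [smul_mul', smul_pow', smul_add, smul_one] at h
    rw [hD', hT', h9] at h
    exact h
  -- `d' ≠ 0`: else `1 + 9T'(θ₂) = 0`, contradicting the independence of `1, θ₂, …, θ₂⁸`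
  have hd0 : d' ≠ 0 := by
    intro h0
    rw [h0, zero_pow three_ne_zero, mul_zero] at hcube'
    have e1 : ∑ k : Fin 9, (((if k = 0 then (1 : ℤ) else 0) : ℤ) : AlgebraicClosure ℚ) * θ ^ (k : ℕ) = 1 := by
      rw [Finset.sum_eq_single (0 : Fin 9)]
      · simp
      · intro k _ hk; simp [hk]
      · intro h; exact absurd (Finset.mem_univ _) h
    have h' : ∑ k : Fin 9, ((((if k = 0 then (1 : ℤ) else 0) + 9 * T' k : ℤ)) : AlgebraicClosure ℚ) *
        θ ^ (k : ℕ) = 0 := by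
      have e : ∑ k : Fin 9, ((((if k = 0 then (1 : ℤ) else 0) + 9 * T' k : ℤ)) : AlgebraicClosure ℚ) *
          θ ^ (k : ℕ) = (∑ k : Fin 9, (((if k = 0 then (1 : ℤ) else 0) : ℤ) : AlgebraicClosure ℚ) *
            θ ^ (k : ℕ)) + 9 * ∑ k : Fin 9, (T' k : AlgebraicClosure ℚ) * θ ^ (k : ℕ) := by
        rw [Finset.mul_sum, ← Finset.sum_add_distrib]
        refine Finset.sum_congr rfl fun k _ ↦ ?_
        push_cast; ring
      rw [e, e1]; exact hcube'.symm
    have hz := eq_zero_of_sum9_eq_zero hκ hζ h'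
    have := congrFun hz 0
    simp at this
    omega
  obtain ⟨β', hβ', hfix⟩ := exists_cubeRoot_smul_eq_self_of_decomp_table μ hθtab T'
  refine ⟨β' / d', ?_, fun σ hσ hσθ ↦ ?_⟩
  · rw [div_pow, hβ', ← hcube', mul_div_assoc, div_self (pow_ne_zero _ hd0), mul_one]
  · have hσd : σ • d' = d' := by rw [hd', smul_sum9, hσθ]
    have hσβ' := hfix σ hσ hσθ
    rw [absoluteGaloisGroup.smul_def] at hσd hσβ' ⊢
    rw [map_div₀, hσβ', hσd]

/-! ### §3 The Kummer class of a layer-two unit lies in GV's `U` -/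

/-- **The class of a `Σ₀`-unit of `ℚ_2` lies in `U`.** `κ` cyclotomic, `H = ker κ`, `Ψ` an `ω`-line
with `3y₀ = 0`, `ζ₃` a primitive cube root of unity, `θ₂ = ζ + ζ²⁶` (`ζ` of order `27`) with its
multiplication table; `a = Σ P_k θ₂^k` with a cofactor `b = Σ B_k θ₂^k`, `a·b = n ∈ ℕ`, `n ≠ 0`, every
prime of `n` under `Σ₀`; ONE cube certificate `a·D³ = 1 + 9T`. Then for every cocycle `F` on `H` of
Kummer type for a cube root `β` of `a`, `[F] ∈ unramifiedSelmer H Ψ 3 Σ₀`.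
[cite: GreenbergVatsal2000, §2 pp. 28–29] [cite: SerreLocalFields1979, Ch. X §3] -/
theorem kummerClass_mem_unramifiedSelmer_layerTwo [hp : Fact (Nat.Prime 3)] (κ : ZpExtension ℚ 3)
    (hκ : κ.IsCyclotomic) (S₀ : Finset (HeightOneSpectrum (𝓞 ℚ)))
    {Ψ : Type} [AddCommGroup Ψ] [DistribMulAction (absoluteGaloisGroup ℚ) Ψ]
    [TopologicalSpace Ψ] [DiscreteTopology Ψ]
    (hΨ : ∀ (σ : absoluteGaloisGroup ℚ) (y : Ψ),
      σ • y = ((modNCyclotomicCharacter ℚ 3 σ : (ZMod 3)ˣ) : ZMod 3).val • y)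
    {y₀ : Ψ} (hy₀ : 3 • y₀ = 0) {ζ₃ : AlgebraicClosure ℚ} (hζ₃ : IsPrimitiveRoot ζ₃ 3)
    {ζ : AlgebraicClosure ℚ} (hζ : IsPrimitiveRoot ζ 27) (μ : Fin 9 → Fin 9 → Fin 9 → ℤ)
    (hθtab : ∀ i j : Fin 9, (ζ + ζ ^ 26) ^ (i : ℕ) * (ζ + ζ ^ 26) ^ (j : ℕ) =
      ∑ k : Fin 9, (μ k i j : AlgebraicClosure ℚ) * (ζ + ζ ^ 26) ^ (k : ℕ))
    (P B D T : Fin 9 → ℤ) (n : ℕ) (hn0 : n ≠ 0)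
    (hab : (∑ k : Fin 9, (P k : AlgebraicClosure ℚ) * (ζ + ζ ^ 26) ^ (k : ℕ)) *
      (∑ k : Fin 9, (B k : AlgebraicClosure ℚ) * (ζ + ζ ^ 26) ^ (k : ℕ)) = (n : AlgebraicClosure ℚ))
    (hnS : ∀ v : HeightOneSpectrum (𝓞 ℚ), ((n : ℕ) : 𝓞 ℚ) ∈ v.asIdeal → v ∈ S₀)
    (hcube : (∑ k : Fin 9, (P k : AlgebraicClosure ℚ) * (ζ + ζ ^ 26) ^ (k : ℕ)) *
      (∑ k : Fin 9, (D k : AlgebraicClosure ℚ) * (ζ + ζ ^ 26) ^ (k : ℕ)) ^ 3 =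
      1 + 9 * ∑ k : Fin 9, (T k : AlgebraicClosure ℚ) * (ζ + ζ ^ 26) ^ (k : ℕ))
    {β : AlgebraicClosure ℚ}
    (hβ : β ^ 3 = ∑ k : Fin 9, (P k : AlgebraicClosure ℚ) * (ζ + ζ ^ 26) ^ (k : ℕ))
    (F : contOneCocycles (discreteTopRep κ.kerSubgroup Ψ))
    (hF : ∀ h : κ.kerSubgroup, ∃ m : ℕ, (h : absoluteGaloisGroup ℚ) • β = ζ₃ ^ m * β ∧ F.1 h = m • y₀) :
    oneCocycleClass (discreteTopRep κ.kerSubgroup Ψ) F ∈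
      unramifiedSelmer κ.kerSubgroup Ψ 3 (↑S₀ : Set (HeightOneSpectrum (𝓞 ℚ))) := by
  haveI : NeZero ((3 : ℕ) : ℚ) := ⟨by norm_num⟩
  set θ := ζ + ζ ^ 26 with hθdef
  set a : AlgebraicClosure ℚ := ∑ k : Fin 9, (P k : AlgebraicClosure ℚ) * θ ^ (k : ℕ) with ha
  set b : AlgebraicClosure ℚ := ∑ k : Fin 9, (B k : AlgebraicClosure ℚ) * θ ^ (k : ℕ) with hb
  have hβ0 : β ≠ 0 := by
    rintro rfl
    rw [zero_pow three_ne_zero] at hβ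
    apply hn0
    have := hab; rw [← hβ, zero_mul] at this; exact_mod_cast this.symm
  -- the place `v₃`
  set v₃ : HeightOneSpectrum (𝓞 ℚ) :=
    (Rat.HeightOneSpectrum.primesEquiv (R := 𝓞 ℚ)).symm ⟨3, Nat.prime_three⟩ with hv₃
  have hv₃3 : ((3 : ℕ) : 𝓞 ℚ) ∈ v₃.asIdeal :=
    (Literature.NumberTheory.Automorphic.BCDT.natCast_mem_asIdeal_iff_primesEquiv_eq v₃ hp.out).mpr
      (by rw [hv₃, Equiv.apply_symm_apply])
  have huniq3 : ∀ v : HeightOneSpectrum (𝓞 ℚ), ((3 : ℕ) : 𝓞 ℚ) ∈ v.asIdeal → v = v₃ := fun v hv ↦ by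
    have h1 := (Literature.NumberTheory.Automorphic.BCDT.natCast_mem_asIdeal_iff_primesEquiv_eq v hp.out).mp hv
    have h2 := (Literature.NumberTheory.Automorphic.BCDT.natCast_mem_asIdeal_iff_primesEquiv_eq v₃ hp.out).mp hv₃3
    exact Rat.HeightOneSpectrum.primesEquiv.injective (Subtype.ext (h1.trans h2.symm))
  -- `ker κ` fixes `θ₂`; inertia away from `3` lies in `ker κ`
  have hkerθ : ∀ σ ∈ κ.kerSubgroup, σ • θ = θ := by
    intro σ hσ
    have hmem := zeta_add_pow_mem_layer_two hκ ζ hζ.pow_eq_one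
    rw [ZpExtension.layer, IntermediateField.mem_fixedField_iff] at hmem
    exact hmem _ (Subgroup.mem_map.mpr ⟨σ, κ.kerSubgroup_le_layerSubgroup 2 hσ, rfl⟩)
  -- conjugate data: `τa = Σ P' θ^k`, `τb = Σ B' θ^k`, `τa·τb = n`
  have hconj : ∀ τ : absoluteGaloisGroup ℚ, ∃ (P' B' : Fin 9 → ℤ),
      τ • a = ∑ k : Fin 9, (P' k : AlgebraicClosure ℚ) * θ ^ (k : ℕ) ∧
      τ • b = ∑ k : Fin 9, (B' k : AlgebraicClosure ℚ) * θ ^ (k : ℕ) ∧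
      τ • a * τ • b = (n : AlgebraicClosure ℚ) := by
    intro τ
    obtain ⟨P', hP'⟩ := exists_intVector9_smul hζ τ P
    obtain ⟨B', hB'⟩ := exists_intVector9_smul hζ τ B
    refine ⟨P', B', hP', hB', ?_⟩
    rw [← smul_mul', hab, absoluteGaloisGroup.smul_def, map_natCast]
  refine mem_unramifiedSelmer_of_conj_of_mem κ.kerSubgroup 3 F (↑S₀) fun τ ↦ ?_
  obtain ⟨P', B', hτa, hτb, hτab⟩ := hconj τ
  obtain ⟨βτ, hβτ, hβτfix⟩ := exists_goodRoot_layerTwo hκ hζ μ hθtab P D T hcube τ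
  -- `βτ = ζ₃^j · τβ`
  have hτβ3 : (τ • β) ^ 3 = τ • a := by rw [← smul_pow', hβ]
  have hτa0 : τ • a ≠ 0 := by
    intro h0; apply hn0
    have := hτab; rw [h0, zero_mul] at this; exact_mod_cast this.symm
  have hτβ0 : τ • β ≠ 0 := by
    intro h0; rw [h0, zero_pow three_ne_zero] at hτβ3; exact hτa0 hτβ3.symm
  obtain ⟨j, -, hj⟩ : ∃ j : ℕ, j < 3 ∧ βτ = ζ₃ ^ j * (τ • β) := by
    have hq : (βτ / (τ • β)) ^ 3 = 1 := by
      rw [div_pow, hβτ, ← hτβ3, div_self (pow_ne_zero _ hτβ0)]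
    obtain ⟨j, hj, hζj⟩ := hζ₃.eq_pow_of_pow_eq_one hq
    exact ⟨j, hj, by rw [hζj, div_mul_cancel₀ _ hτβ0]⟩
  -- the Kummer cocycles of `τa` on `ker κ`
  have hkera : ∀ σ ∈ κ.kerSubgroup, σ • (τ • a) = τ • a := fun σ hσ ↦ by
    rw [hτa, smul_sum9, hkerθ σ hσ]
  obtain ⟨fτ, hfτc, hfτcoc, hfτrel⟩ := exists_kummerCocycle (p := 3) κ.kerSubgroup hΨ y₀ hy₀ hζ₃
    hτa0 hkera hβτ
  obtain ⟨Fτ, cτ, hFτ, hcτ⟩ := exists_class_of_cocycle κ.kerSubgroup le_rfl fτ hfτc hfτcoc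
  obtain ⟨f₁, hf₁c, hf₁coc, hf₁rel⟩ := exists_kummerCocycle (p := 3) κ.kerSubgroup hΨ y₀ hy₀ hζ₃
    hτa0 hkera hτβ3
  obtain ⟨F₁, c₁, hF₁, hc₁⟩ := exists_class_of_cocycle κ.kerSubgroup le_rfl f₁ hf₁c hf₁coc
  have hβτ0 : βτ ≠ 0 := by
    rw [hj]; exact mul_ne_zero (pow_ne_zero _ (hζ₃.ne_zero three_ne_zero)) hτβ0
  have hvanish : ∀ σ ∈ κ.kerSubgroup, σ • βτ = βτ → fτ σ = 0 := by
    intro σ hσ hfix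
    obtain ⟨m, hm, hfm⟩ := hfτrel σ hσ
    rw [hfix] at hm
    have hζm : ζ₃ ^ m = 1 := by
      have h1 : ζ₃ ^ m * βτ = 1 * βτ := by rw [one_mul]; exact hm.symm
      exact mul_right_cancel₀ hβτ0 h1
    obtain ⟨k, rfl⟩ := (hζ₃.pow_eq_one_iff_dvd m).mp hζm
    rw [hfm, mul_nsmul, hy₀, nsmul_zero]
  have h3case : ∀ σ ∈ inertia v₃, σ ∈ κ.kerSubgroup → fτ σ = 0 := fun σ hσ hσker ↦
    hvanish σ hσker (hβτfix σ (inertia_le_decomp v₃ hσ) (hkerθ σ hσker))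
  refine ⟨fτ, Fτ, hFτ, ?_, ?_, ?_⟩
  · -- `conj_τ [F] = [F₁] = [Fτ]`
    have e1 : conjH1 κ.kerSubgroup Ψ τ (oneCocycleClass (discreteTopRep κ.kerSubgroup Ψ) F) =
        oneCocycleClass (discreteTopRep κ.kerSubgroup Ψ) F₁ :=
      conjH1_eq_of_kummer (p := 3) κ.kerSubgroup hΨ hy₀ hζ₃ hβ0 τ F F₁ hF
        (fun h ↦ by obtain ⟨m, hm, hfm⟩ := hf₁rel h h.2; exact ⟨m, hm, by rw [hF₁]; exact hfm⟩)
    have e2 : oneCocycleClass (discreteTopRep κ.kerSubgroup Ψ) Fτ =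
        oneCocycleClass (discreteTopRep κ.kerSubgroup Ψ) F₁ :=
      class_eq_of_root_mul_pow (p := 3) κ.kerSubgroup hΨ hy₀ hζ₃ hτβ0 j F₁ Fτ
        (fun h ↦ by obtain ⟨m, hm, hfm⟩ := hf₁rel h h.2; exact ⟨m, hm, by rw [hF₁]; exact hfm⟩)
        (fun h ↦ by
          obtain ⟨m, hm, hfm⟩ := hfτrel h h.2
          exact ⟨m, by rw [← hj]; exact hm, by rw [hFτ]; exact hfm⟩)
    rw [e1, e2]
  · -- `v ∉ Σ₀`
    intro v hvS σ hσ hσker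
    by_cases hv3 : ((3 : ℕ) : 𝓞 ℚ) ∈ v.asIdeal
    · rw [huniq3 v hv3] at hσ
      exact h3case σ hσ hσker
    · refine hvanish σ hσker ?_
      have hint : IsIntegral (𝓞 ℚ) (τ • a) := by rw [hτa]; exact isIntegral_sum9 hζ P'
      have hbint : IsIntegral (𝓞 ℚ) (τ • b) := by rw [hτb]; exact isIntegral_sum9 hζ B'
      exact smul_eq_self_of_mem_inertia_of_pow_eq_of_dvd (p := 3) hζ₃ hint hbint hτab hβτ hv3
        (fun hnv ↦ hvS (hnS v hnv)) hσ (hkera σ hσker)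
  · -- `v ∣ 3`
    intro v hv3 σ hσ hσker
    rw [huniq3 v hv3] at hσ
    exact h3case σ hσ hσker

end LayerTwoField

end Summit.BirchSwinnertonDyer.Rank1Residual.Additive

end
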